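import Mathlib
import Literature.MathematicalPhysics.QuantumFieldTheory.Balaban1983to89.B16Lem384Induction
import Literature.MathematicalPhysics.QuantumFieldTheory.Balaban1983to89.B16Improved189
import Literature.MathematicalPhysics.QuantumFieldTheory.Balaban1983to89.B16Ineq197ClassOne

/-!
# `Balaban1983to89.B16Improved189FullBudget` — [Balaban1989LargeFieldII] p. 387 ll. 25–29: the IMPROVED BOUND (1.89)
WITH THE FULL BUDGET, `𝐓′_k(X)1 ≤ exp(−2(1+β₀)⁻¹p₀(g_k) − κ₁d_k(X))`, from the inductive statement (1.80) STRENGTHENED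
by a terminal term — the printed induction of pp. 384–387 re-run with that term in the bookkeeping model of `Step.Budget`

T. Bałaban, *Large field renormalization. II. Localization, exponentiation, and bounds for the 𝐑 operation*, Commun.
Math. Phys. **122** (1989) 355–392, doi:10.1007/bf01238433 [Balaban1989LargeFieldII] (cell paper B16 = [V]; PDF held
`paper:balaban1989-cmp122-large-field-ii`, journal page = PDF page + 354; pp. 384–387 = PDF 30–33).

statement-level bookkeeping of a published proof with citation tags; proofs kernel-checked; nothing here is a claim
about the Yang–Mills mass gap

CITATION HEADER (lean-in-tree rule 2026-08-18) / WHAT IS REPRODUCED.  p. 387 [PDF 33] ll. 21–29, verbatim: *"Let us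
draw some conclusions from the statement. At first, the domain X in the definition (1.71) satisfies the assumption of
the statement with K = 0, therefore κ_k(X) ≧ 0, and we have the fundamental inequality 𝐓′_k(X)1 ≦
exp(−2(1+β₀)^{−1}p₀(g_k)). (1.89) … Next, we have noticed already that the inequality (1.79) holds for the
𝐓-operation connected with an arbitrary large field region. The inequality (1.80) holds quite generally for such
regions, hence also an improved bound (1.89), with the additional term −κ₁d_k(X) in the exponential. This implies the
inequality (2.50) [III], hence Corollary 3."*  p. 384 [30]: *"If Z is a component of Z_j, and j(Z) is the index of a
first large field region contained in Z, then we write the factor connected with Z in the form exp(−κ_j(Z) −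
2p₀(g_{j(Z)})). The factor exp(−κ_j(Z)) controls K renormalization steps, under the assumption that no large fields
are created in these steps, where the number K is the smallest positive integer having the property that the domain
S^K(Z) … satisfies the conditions (i), (ii), with N = R_j. More precisely this means that κ_j(Z) ≧ Σ_{n=j+1}^{j+K}
O(1)M^dR_n^{d+1}d′_n(S^{n−j}(Z)). (1.80) We prove this statement by an induction with respect to j."*  pp. 385–387:
the base case (1.81)–(1.82) with its located condition *"satisfied for p₀ large, and g₁ sufficiently small"*, case 1
(1.83) *"Z = S(Z₀) … κ_{j+1}(Z) = κ_j(Z₀) − O(1)M^dR_{j+1}^{d+1}d′_{j+1}(Z)"*, the reset of p. 386 *"We define κ_{j+1}(Z)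
= p₀(g_j) − O(1)M^dR_{j+1}^{d+1}d′_{j+1}(Z). It satisfies (1.80), because Z is a small domain"*, and case 2, the merger
(1.85)–(1.88) *"for p₀ large and γ small enough. This completes the inductive proof of the statement."*  [IV] = T.
Bałaban, *Large field renormalization. I*, Commun. Math. Phys. **122** (1989) 175–202 [Balaban1989LargeFieldI] p. 177
condition (i) (*"contained in a cube of the size 100MR_k"*); [B12] = [Balaban1987RG1] p. 257 (the tree length
`d_j(X)`, in `M`-cube units).

THE LOCATED OBJECTION THIS FILE ANSWERS (audit cell `pub-balaban`, GAPS row G-adv3-6; tree `B16Improved189`, header: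
*"The FULL-budget form printed on p. 387 (−2(1+β₀)⁻¹p₀(g_k) − κ₁d_k(X)) is NOT derived here: it needs (1.80)
strengthened by the term κ₁ d_{j+K}(S^K(Z))"*; G-adv3-6 (3): *"SKETCH (not written, not checked)"*).  For the domains
`X` of (1.71) the statement (1.80) has `K = 0` and is EMPTY (`Step.Budget.controls_zero_iff`), so the printed "hence"
supplies no term `−κ₁d_k(X)`; `B16Improved189` repairs the sentence by paying the term from HALF of the `p₀`-budget
(`improved189_of_condition_i` / `_of_budget_general`: `exp(−(1+β₀)⁻¹p₀(g_k) − κ₁d_k(X))`), which is what the Cor-3 chain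
consumes today (`B16Cor3Wilson.hw_of_improved189`, `c₀ = (1+β₀)⁻¹p₀(g_k)`).  THIS FILE writes and checks the sketched
route to the FULL budget: the inductive statement is strengthened to

  (1.80)⁺   `κ_j(Z) ≧ Σ_{n=j+1}^{j+K} O(1)M^dR_n^{d+1}d′_n(S^{n−j}(Z)) + t_j(Z)`,

with a TERMINAL TERM `t_j(Z) ≥ 0` attached to every component (print's candidate: `t_j(Z) = κ₁d_{j+K}(S^K(Z))`, the
tree length of the terminal domain at its own scale), and the printed induction is re-run verbatim with that term: in
the bookkeeping model (1.80)⁺ for the budget `κ` IS (1.80) for the budget `κ − t` — `Step.Budget.Controls b j K (κ − t) s`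
— so NO new definition is introduced and every case lemma of the tree applies BY NAME to the lowered budget.  The three
places where the term is not simply carried are exactly the three places where print invokes a located smallness
condition, and there it is ABSORBED into that condition: the base case (1.82) (coefficient condition `2Q ≤ a` ↦ `3Q ≤
a`, the term bounded like the creation cost, `t ≤ Q(d′+1)`), the reset of p. 386 (`hsmall` charged with `+ t`), and the
merger (1.85)–(1.88) (a terminal sub-additivity per split, `t(T) ≤ t({x}) + t(T∖{x}) + E_t`, its overshoot `E_t` added
to print's `E + D ≤ q`); the continuation (1.83) carries the term UNCHANGED (the terminal domain of `Z = S(Z₀)` is that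
of `Z₀`: `S^{K−1}(S(Z₀)) = S^K(Z₀)` at the same scale `j+K`).  At `K = 0`, (1.80)⁺ reads `κ_k(X) ≧ t_k(X) = κ₁d_k(X)`,
and the factor form of p. 384 gives the improved (1.89) with the FULL budget.

WHAT THIS FILE PROVES (kernel-checked, zero `sorry`, theorems only — no `def`/`structure`; axioms standard; BY NAME:
`Step.Budget.{Controls, Consts.cost, ScaleData, ScaleData.Invariant, controls_zero_iff, base_182, case1_183,
reset_p386, merge, merge_eq_186, fundIneq189_of_budget}`, `Step.FundIneq189`, `B16Lem384Induction.{controls_mono_κ,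
controls_iterate_cont}`, `B16Improved189.improved189_of_halved_budget` — nothing re-proved):
§1 (1.80)⁺ AS (1.80) FOR THE LOWERED BUDGET: `controlsT_iff` (`Controls b j K (κ − t) s ↔ Σ cost + t ≤ κ`),
   `controls_of_controlsT` (`t ≥ 0`: (1.80)⁺ ⇒ (1.80)), `controlsT_mono`, `controlsT_zero_iff` (`K = 0`: (1.80)⁺ ↔
   `t ≤ κ` — the sentence p. 387 wants), `invariant_of_invariantT` (componentwise).
§2 THE SINGLE-DOMAIN CASES WITH THE TERM: `case1T_183` ((1.83): term carried unchanged), `controlsT_iterate_cont`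
   (p. 384 «controls K renormalization steps» with the term), `baseT_182` / `bornT_controls` ((1.82) with `t ≤ Q(d′+1)`
   and `3Q ≤ a`; = print's `base_182` for the coefficient `a − Q`: `bornT_controls_of_base_182`), `resetT_p386` (p. 386
   with `hsmall` charged `+ t`).
§3 THE MERGER WITH THE TERM: `mergeT_step` (the binary chain (1.86)–(1.88) with `htsub`, `hbudget : E + E_t + D ≤ q`),
   `mergeT_rhs_le` (print's inner induction on the number of domains over the subfamilies of the merging family, for
   `rhs + t`), `mergeT_controls` ((1.80)⁺ at scale `j+1` for the merged component whose budget is at least (1.85), the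
   single-piece base supplied by (1.80)⁺ at scale `j` for old pieces — `hsingleT_old` — and by `bornT` for new ones —
   `hsingleT_new`).
§4 THE OUTER INDUCTION ON `j` for (1.80)⁺: `invariantT_all` (from (1.80)⁺ at a first scale and a step at every scale;
   the step is assembled by the consumer from §2–§3 exactly as `B16Lem384Induction.Transition` assembles (1.80)).
§5 THE CONCLUSION OF p. 387 WITH THE FULL BUDGET: `terminal_le_kappa_of_controlsT` (`K = 0 ⇒ t_k(X) ≤ κ_k(X)`),
   **`improved189_full`** (`𝐓′_k(X)1 ≤ exp(−κ_k(X) − P)`, `κ₁d_k(X) ≤ κ_k(X)`, `2(1+β₀)⁻¹p₀(g_k) ≤ P` ⇒ `𝐓′_k(X)1 ≤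
   exp(−2(1+β₀)⁻¹p₀(g_k) − κ₁d_k(X))`), `improved189_full_of_controlsT`, `improved189_full_of_invariantT`,
   **`improved189_full_of_history`** (base + steps + horizon 0 ⇒ the full-budget improved (1.89)), and the comparisons
   `fundIneq189_of_improved189_full` (⇒ (1.89) proper, `Step.FundIneq189`), `improved189_half_of_full` (⇒ the tree's
   half-budget shape of `B16Improved189.improved189_of_fundIneq`), `hw_full_shape` (the `hw`-currency of
   `B16Cor3Wilson`: `exp(−c₀ − κ₁d_k(X))` with `c₀ = 2(1+β₀)⁻¹p₀(g_k)`).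
§6 NON-VACUITY: `toy_history_full` — explicit bookkeeping constants, a region born with a POSITIVE terminal term under
   `3Q ≤ a`, one continuation step to its horizon, and the full-budget conclusion firing with `κ₁d_k(X) = t > 0`: the
   strengthened hypotheses are jointly satisfiable and the added exponent is not zero.
§7 THE BIRTH/RESET BINDER `ht` IN THE ℤᵈ INDEX MODEL, from the DEFINITION of the horizon (the terminal domain satisfies
   condition (i)) through the two-lattice dictionary of `B16Ineq197ClassOne` and pv22's `TreeLength` BY NAME:
   `terminal_treeLen_le_of_condI` (`d(S^K(Z)) ≤ (Nsz·R)^d − 1` M-cubes), **`ht_of_condI`** (`ht` modulo the located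
   clause `κ₁((Nsz·R)^d − 1) ≤ Q`), `hgeo_of_condI` (the horizon-0 `hgeo` of `B16Improved189.improved189_of_condition_i`).
HONEST SCOPE.  (a) Bookkeeping model, as in `B16Lem384Induction`: components, budgets, size profiles, horizons and now
terminal terms are abstract data; the GEOMETRY behind the terminal binders — at birth/reset `t ≤ Q(d′+1)` (located
reason: the terminal domain `S^K(Z)` satisfies (i) at scale `j+K`, so `d_{j+K}(S^K(Z)) ≤ (100R_{j+K})^d ≤ (100LR_j)^d`
M-cubes by (2.9) [III], against `Q = O(1)(64)^dM^dL^{d+1}R_j^{d+2}` — a smallness condition on `κ₁` of the kind p. 389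
prints, cf. `B16Improved189.size_trade_of_exponents`), at a merger `t(T) ≤ t({x}) + t(T∖{x}) + E_t` (located reason:
the pieces' terminal scales do not exceed the union's, coarsening does not lengthen trees beyond collar rounding, and
joining two trees through a touching pair of cubes costs `≤ 2d`, p. 388 / `B16MergeGeometry`) — is NOT proved here; it
is carried as named hypotheses beside print's own (`hrhs`/`hcost`/`hcond`, `hsmall`, `hleaf`/`hP`/`hc`/`hsub`/
`hbudget`), except that §7 reduces the birth/reset binder, in the ℤᵈ index model, to condition (i) for the terminal index
set (the definition of `K`) plus ONE located clause on `κ₁`; the merger binder `htsub` stays reader-level geometry.  (b) The located conditions change by constants only (`2Q ≤ a` ↦ `3Q ≤ a`; `E + D ≤ q` ↦ `E + E_t + D ≤ q`;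
`hsmall + t`) — covered by print's *"p₀ large, and g₁ sufficiently small"* / *"for p₀ large and γ small enough"*, which
name no constant.  (c) Whether (2.50) [III] needs the full or the halved budget cannot be read off [V] (no line of that
derivation is printed: GAPS G-adv3-1, G-adv3-2, G-B16-08 (c)); the Cor-3 chain of the tree closes with either (constants
of `E₊` only).  (d) Nothing of (1.79)–(1.89) is asserted; NOT summit progress.  Seat `pub-ymgap-dag-n13-b` (g2), YM-DAG
node N13 [B16] Cor. 3, `--supports stmt-QuantumFields-19183`.
-/

namespace Literature.MathematicalPhysics.QuantumFieldTheory.Balaban1983to89.B16Improved189FullBudget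

open Literature.MathematicalPhysics.QuantumFieldTheory.Balaban1983to89
open Literature.MathematicalPhysics.QuantumFieldTheory.Balaban1983to89.Step
open Literature.MathematicalPhysics.QuantumFieldTheory.Balaban1983to89.Step.Budget

/-! ## §1. (1.80)⁺ — the inductive statement with a terminal term — is (1.80) for the lowered budget -/

/-- **(1.80)⁺** in the bookkeeping model: `Controls b j K (κ − t) s` says exactly
`Σ_{n=j+1}^{j+K} O(1)M^dR_n^{d+1}d′_n(S^{n−j}(Z)) + t ≤ κ_j(Z)` — (1.80) p. 384 with the terminal term `t = t_j(Z)` added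
to its right-hand side.  No new definition: the strengthened statement for the budget `κ` is the printed one for
`κ − t`. [cite: Balaban1989LargeFieldII, (1.80) p.384] -/
theorem controlsT_iff (b : Budget.Consts) (j K : ℕ) (κ t : ℝ) (s : ℕ → ℝ) :
    Controls b j K (κ - t) s ↔ ∑ n ∈ Finset.Ioc j (j + K), b.cost n (s n) + t ≤ κ := by
  unfold Controls
  constructor <;> intro h <;> linarith

/-- `t = 0`: (1.80)⁺ is (1.80). [cite: Balaban1989LargeFieldII, (1.80) p.384] -/
theorem controlsT_zero (b : Budget.Consts) (j K : ℕ) (κ : ℝ) (s : ℕ → ℝ) :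
    Controls b j K (κ - 0) s ↔ Controls b j K κ s := by
  rw [sub_zero]

/-- (1.80)⁺ with a non-negative terminal term implies (1.80) (monotonicity in the budget,
`B16Lem384Induction.controls_mono_κ`). [cite: Balaban1989LargeFieldII, (1.80) p.384] -/
theorem controls_of_controlsT (b : Budget.Consts) (j K : ℕ) {κ t : ℝ} (s : ℕ → ℝ) (ht : 0 ≤ t)
    (h : Controls b j K (κ - t) s) : Controls b j K κ s :=
  B16Lem384Induction.controls_mono_κ b j K s h (by linarith)

/-- (1.80)⁺ is monotone in the budget and antitone in the terminal term. [cite: Balaban1989LargeFieldII, (1.80) p.384] -/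
theorem controlsT_mono (b : Budget.Consts) (j K : ℕ) {κ κ' t t' : ℝ} (s : ℕ → ℝ)
    (h : Controls b j K (κ - t) s) (hκ : κ ≤ κ') (ht : t' ≤ t) : Controls b j K (κ' - t') s :=
  B16Lem384Induction.controls_mono_κ b j K s h (by linarith)

/-- `K = 0`: (1.80)⁺ reads `t ≤ κ` — at the horizon the budget dominates the terminal term (where (1.80) itself only
says `0 ≤ κ`, `Step.Budget.controls_zero_iff`; p. 387 «satisfies the assumption of the statement with K = 0, therefore
κ_k(X) ≧ 0»). [cite: Balaban1989LargeFieldII, p.387] -/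
theorem controlsT_zero_iff (b : Budget.Consts) (j : ℕ) (κ t : ℝ) (s : ℕ → ℝ) :
    Controls b j 0 (κ - t) s ↔ t ≤ κ := by
  rw [controls_zero_iff]
  exact sub_nonneg

/-- (1.80)⁺ for every component of scale-`j` bookkeeping data (terminal terms `t`, all `≥ 0`) implies the tree's
`ScaleData.Invariant` ((1.80) for every component). [cite: Balaban1989LargeFieldII, (1.80) p.384] -/
theorem invariant_of_invariantT (b : Budget.Consts) {j : ℕ} (D : ScaleData j) (t : D.Comp → ℝ)
    (ht : ∀ Z, 0 ≤ t Z) (hD : ∀ Z, Controls b j (D.K Z) (D.κ Z - t Z) (D.size Z)) : D.Invariant b :=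
  fun Z => controls_of_controlsT b j (D.K Z) (D.size Z) (ht Z) (hD Z)

/-! ## §2. The single-domain cases of pp. 385–386 with the terminal term -/

/-- **CASE 1, (1.83), WITH THE TERM CARRIED UNCHANGED**: «Z = S(Z₀) … κ_{j+1}(Z) = κ_j(Z₀) − O(1)M^dR_{j+1}^{d+1}
d′_{j+1}(Z)» — the terminal domain of `Z` is that of `Z₀` (`S^{K−1}(S(Z₀)) = S^K(Z₀)`, same scale `j+K`), so the same `t`
serves: (1.80)⁺ at scale `j` for `(κ, t)` gives (1.80)⁺ at scale `j+1` for `(κ − cost, t)`.  `case1_183` applied to the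
lowered budget. [cite: Balaban1989LargeFieldII, (1.83) p.385] -/
theorem case1T_183 (b : Budget.Consts) (j K : ℕ) (hK : 1 ≤ K) (κ t : ℝ) (s : ℕ → ℝ)
    (h : Controls b j K (κ - t) s) :
    Controls b (j + 1) (K - 1) (κ - b.cost (j + 1) (s (j + 1)) - t) s := by
  have h1 := case1_183 b j K hK (κ - t) s h
  have e : κ - t - b.cost (j + 1) (s (j + 1)) = κ - b.cost (j + 1) (s (j + 1)) - t := by ring
  rw [e] at h1
  exact h1

/-- p. 384 «controls K renormalization steps, under the assumption that no large fields are created in these steps», with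
the term: after `m ≤ K` pure continuations the budget lowered by the paid costs still satisfies (1.80)⁺ with the SAME
terminal term for the remaining `K − m` steps.  `B16Lem384Induction.controls_iterate_cont` on the lowered budget. [cite: Balaban1989LargeFieldII, (1.80) p.384, (1.83) p.385] -/
theorem controlsT_iterate_cont (b : Budget.Consts) (j K : ℕ) (κ t : ℝ) (s : ℕ → ℝ)
    (h : Controls b j K (κ - t) s) :
    ∀ m, m ≤ K → Controls b (j + m) (K - m) (κ - ∑ n ∈ Finset.Ioc j (j + m), b.cost n (s n) - t) s := by
  intro m hm
  have h1 := B16Lem384Induction.controls_iterate_cont b j K (κ - t) s h m hm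
  have e : κ - t - ∑ n ∈ Finset.Ioc j (j + m), b.cost n (s n)
      = κ - ∑ n ∈ Finset.Ioc j (j + m), b.cost n (s n) - t := by ring
  rw [e] at h1
  exact h1

/-- **THE BASE CASE (1.82) WITH THE TERM ABSORBED** (p. 385): from «κ₁(Z) ≧ a(d′₁(Z)+1) − O(1)M^dR₁^{d+1}d′₁(Z)»
(`hκ`), the majorant (1.81) `RHS(1.80) ≤ Q(d′+1)` (`hrhs`), the same bound for the creation cost (`hcost`) AND FOR THE
TERMINAL TERM (`ht : t ≤ Q(d′+1)` — located reason in the header: the terminal domain satisfies (i) at its scale), and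
the located condition with its constant enlarged, `3Q ≤ a` (print: `2Q ≤ a`, «satisfied for p₀ large, and g₁
sufficiently small»), follows (1.80)⁺: `rhs + t ≤ κ`.  Arithmetic. [cite: Balaban1989LargeFieldII, (1.81)–(1.82) p.385] -/
theorem baseT_182 (κ a Q cost rhs s t : ℝ) (hs : 0 ≤ s) (hκ : a * (s + 1) - cost ≤ κ) (hrhs : rhs ≤ Q * (s + 1))
    (hcost : cost ≤ Q * (s + 1)) (ht : t ≤ Q * (s + 1)) (hcond : 3 * Q ≤ a) : rhs + t ≤ κ := by
  have h := mul_le_mul_of_nonneg_right hcond (show (0 : ℝ) ≤ s + 1 by linarith)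
  linarith

/-- The base case in `Controls` form: «the first induction step» at a scale `m` for a region with bracket coefficient `a`,
size `d′ ≥ 0`, size profile `size`, horizon `K`, majorant constant `Q`, terminal term `t ≤ Q(d′+1)` and `3Q ≤ a` —
(1.80)⁺ at scale `m` for every budget `κ ≥ a(d′+1) − O(1)M^dR_m^{d+1}d′` ((1.82) is an inequality). [cite: Balaban1989LargeFieldII, (1.82) p.385] -/
theorem bornT_controls (b : Budget.Consts) (m K : ℕ) (κ a Q t d' : ℝ) (size : ℕ → ℝ) (hd' : 0 ≤ d')
    (hκ : a * (d' + 1) - b.cost m d' ≤ κ)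
    (hrhs : ∑ n ∈ Finset.Ioc m (m + K), b.cost n (size n) ≤ Q * (d' + 1))
    (hcost : b.cost m d' ≤ Q * (d' + 1)) (ht : t ≤ Q * (d' + 1)) (hcond : 3 * Q ≤ a) :
    Controls b m K (κ - t) size := by
  rw [controlsT_iff]
  exact baseT_182 κ a Q (b.cost m d') _ d' t hd' hκ hrhs hcost ht hcond

/-- THE SAME READ THROUGH PRINT'S OWN LEMMA: the base case with the term is `Step.Budget.base_182` for the coefficient
`a − Q` (whose located condition `2Q ≤ a − Q` is `3Q ≤ a`), the certified budget `(a − Q)(d′+1) − cost` lying below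
`κ − t` because `t ≤ Q(d′+1)`. [cite: Balaban1989LargeFieldII, (1.82) p.385] -/
theorem bornT_controls_of_base_182 (b : Budget.Consts) (m K : ℕ) (κ a Q t d' : ℝ) (size : ℕ → ℝ) (hd' : 0 ≤ d')
    (hκ : a * (d' + 1) - b.cost m d' ≤ κ)
    (hrhs : ∑ n ∈ Finset.Ioc m (m + K), b.cost n (size n) ≤ Q * (d' + 1))
    (hcost : b.cost m d' ≤ Q * (d' + 1)) (ht : t ≤ Q * (d' + 1)) (hcond : 3 * Q ≤ a) :
    Controls b m K (κ - t) size := by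
  have h := base_182 ((a - Q) * (d' + 1) - b.cost m d') (a - Q) Q (b.cost m d')
    (∑ n ∈ Finset.Ioc m (m + K), b.cost n (size n)) d' hd' le_rfl hrhs hcost (by linarith)
  refine B16Lem384Induction.controls_mono_κ b m K size h ?_
  nlinarith

/-- **THE RESET OF p. 386 WITH THE TERM CHARGED TO ITS SMALLNESS CONDITION**: «κ_{j+1}(Z) = p₀(g_j) − O(1)M^dR_{j+1}^{d+1}
d′_{j+1}(Z). It satisfies (1.80), because Z is a small domain … hence K = R_{j+1} for Z» — with `hsmall` asked of the
costs PLUS the terminal term (located reason in the header: the terminal domain of a small domain is small), (1.80)⁺ at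
scale `j+1` for the budget `p − cost` and the term `t`.  `reset_p386` for `p − t`. [cite: Balaban1989LargeFieldII, §1 p.386] -/
theorem resetT_p386 (b : Budget.Consts) (j K' : ℕ) (p t : ℝ) (s : ℕ → ℝ)
    (hsmall : ∑ n ∈ Finset.Ioc j (j + 1 + K'), b.cost n (s n) + t ≤ p) :
    Controls b (j + 1) K' (p - b.cost (j + 1) (s (j + 1)) - t) s := by
  have h1 := reset_p386 b j K' (p - t) s (by linarith)
  have e : p - t - b.cost (j + 1) (s (j + 1)) = p - b.cost (j + 1) (s (j + 1)) - t := by ring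
  rw [e] at h1
  exact h1

/-! ## §3. The merger (1.85)–(1.88) with the terminal term -/

/-- **THE BINARY STEP (1.86)–(1.88) WITH THE TERM** (p. 387): from (1.86) (`h186`), «2p₀(g_{j(X)}) + 2p₀(g_{j(Y)}) −
2p₀(g_{j(Z)}) ≧ 2(1+β₀)^{−1}p₀(g_{j+1})» (`hP`), the cost inequality «d′_{j+1}(X) + d′_{j+1}(Y) + 2d ≧ d′_{j+1}(Z)» (`hc`),
the sub-additivity of the (1.80)-sums with overshoot `E` (`hsub`), THE TERMINAL SUB-ADDITIVITY with overshoot `E_t`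
(`htsub`), (1.80)⁺ for `X` and for `Y` (`hX`, `hY`) and the located condition «for p₀ large and γ small enough» now
reading `E + E_t + D ≤ q` (`hbudget`) follows (1.80)⁺ for `Z`.  `linarith`. [cite: Balaban1989LargeFieldII, (1.86)–(1.88) pp.386–387] -/
theorem mergeT_step (κZ κX κY PX PY PZ cX cY cZ rhsZ rhsX rhsY tZ tX tY q E Et D : ℝ)
    (h186 : κZ = κX + κY + (PX + PY - PZ) + (cX + cY - cZ)) (hP : q ≤ PX + PY - PZ)
    (hc : cZ ≤ cX + cY + D) (hsub : rhsZ ≤ rhsX + rhsY + E) (htsub : tZ ≤ tX + tY + Et)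
    (hX : rhsX + tX ≤ κX) (hY : rhsY + tY ≤ κY) (hbudget : E + Et + D ≤ q) : rhsZ + tZ ≤ κZ := by
  linarith

/-- **PRINT'S INNER INDUCTION ON THE NUMBER OF DOMAINS, WITH THE TERM** (p. 386 «by an induction with respect to the
number of domains in {Z_j^{(n)}, Z_{j+1}^{(i)}} … Take a maximal tree graph … endpoints … Remove the vertex …»), run over
the SUBFAMILIES of the merging family `S` exactly as `B16Lem384Induction.MergeCase.rhs_le_merge_of_subset` runs it for
(1.80): pieces `ι` with contributions `contrib` (bracket + `2p₀`-term), family functions `cost`, `P`, `rhs` (the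
(1.80)-sum of the union) and `t` (the terminal term of the union), a connectedness predicate with the endpoint property
(`hleaf`), the single-piece base (`hsingle`, for `rhs + t`), the split binders `hP`, `hc`, `hsub`, `htsub` asked of
subfamilies only, and `hbudget : E + E_t + D ≤ q`.  Conclusion: `rhs T + t T ≤ merge contrib T (cost T) (P T)` for every
connected non-empty `T ⊆ S` — (1.80)⁺ with the budget (1.85) (`Step.Budget.merge`). [cite: Balaban1989LargeFieldII, (1.85)–(1.88) pp.386–387] -/
theorem mergeT_rhs_le {ι : Type*} [DecidableEq ι] (contrib : ι → ℝ) (cost P rhs t : Finset ι → ℝ)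
    (S : Finset ι) (Conn : Finset ι → Prop) (q E Et D : ℝ)
    (hleaf : ∀ T, T ⊆ S → Conn T → 2 ≤ T.card → ∃ x ∈ T, Conn (T.erase x))
    (hsingle : ∀ x ∈ S, rhs {x} + t {x} ≤ merge contrib {x} (cost {x}) (P {x}))
    (hP : ∀ T x, T ⊆ S → x ∈ T → 2 ≤ T.card → q ≤ P {x} + P (T.erase x) - P T)
    (hc : ∀ T x, T ⊆ S → x ∈ T → 2 ≤ T.card → Conn T → Conn (T.erase x) →
      cost T ≤ cost {x} + cost (T.erase x) + D)
    (hsub : ∀ T x, T ⊆ S → x ∈ T → 2 ≤ T.card → Conn T → Conn (T.erase x) →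
      rhs T ≤ rhs {x} + rhs (T.erase x) + E)
    (htsub : ∀ T x, T ⊆ S → x ∈ T → 2 ≤ T.card → Conn T → Conn (T.erase x) →
      t T ≤ t {x} + t (T.erase x) + Et)
    (hbudget : E + Et + D ≤ q) :
    ∀ T, T ⊆ S → Conn T → T.Nonempty → rhs T + t T ≤ merge contrib T (cost T) (P T) := by
  intro T
  induction T using Finset.strongInduction with
  | H T ih =>
    intro hTS hconn hne
    by_cases h2 : 2 ≤ T.card
    · obtain ⟨x, hx, hconnY⟩ := hleaf T hTS hconn h2
      have hYne : (T.erase x).Nonempty := by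
        rw [← Finset.card_pos, Finset.card_erase_of_mem hx]
        omega
      have hYS : T.erase x ⊆ S := (Finset.erase_subset x T).trans hTS
      have ihY := ih (T.erase x) (Finset.erase_ssubset hx) hYS hconnY hYne
      exact mergeT_step _ _ _ _ _ _ _ _ _ _ _ _ _ _ _ q E Et D
        (merge_eq_186 contrib T x hx (cost T) (P T) (cost {x}) (P {x}) (cost (T.erase x)) (P (T.erase x)))
        (hP T x hTS hx h2) (hc T x hTS hx h2 hconn hconnY) (hsub T x hTS hx h2 hconn hconnY)
        (htsub T x hTS hx h2 hconn hconnY) (hsingle x (hTS hx)) ihY hbudget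
    · have hcard : T.card = 1 := by
        have := Finset.card_pos.mpr hne
        omega
      obtain ⟨y, rfl⟩ := Finset.card_eq_one.mp hcard
      exact hsingle y (hTS (Finset.mem_singleton_self y))

/-- THE SINGLE-PIECE BASE FOR AN OLD PIECE («the situation covered by (1.83)»): a component `Z₀` of `Z_j` with horizon
`K ≥ 1`, budget `κ`, profile `s` and terminal term `t` satisfying (1.80)⁺ at scale `j` has, at scale `j+1`, its own
(1.80)-sum plus `t` bounded by its bracket `κ` minus its own cost — `case1T_183` unfolded. [cite: Balaban1989LargeFieldII, (1.83) p.385, p.386] -/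
theorem hsingleT_old (b : Budget.Consts) (j K : ℕ) (hK : 1 ≤ K) (κ t : ℝ) (s : ℕ → ℝ)
    (h : Controls b j K (κ - t) s) :
    ∑ n ∈ Finset.Ioc (j + 1) (j + 1 + (K - 1)), b.cost n (s n) + t ≤ κ - b.cost (j + 1) (s (j + 1)) := by
  have h1 := case1T_183 b j K hK κ t s h
  rw [controlsT_iff] at h1
  exact h1

/-- THE SINGLE-PIECE BASE FOR A NEW PIECE («or by the first induction step»): a region born at scale `j+1` with
bracket `a(d′+1)`, majorant constant `Q`, terminal term `t ≤ Q(d′+1)` and `3Q ≤ a` has its own (1.80)-sum plus `t`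
bounded by its bracket minus its creation cost — `baseT_182`. [cite: Balaban1989LargeFieldII, (1.82) p.385, p.386] -/
theorem hsingleT_new (b : Budget.Consts) (m K : ℕ) (a Q t d' : ℝ) (size : ℕ → ℝ) (hd' : 0 ≤ d')
    (hrhs : ∑ n ∈ Finset.Ioc m (m + K), b.cost n (size n) ≤ Q * (d' + 1))
    (hcost : b.cost m d' ≤ Q * (d' + 1)) (ht : t ≤ Q * (d' + 1)) (hcond : 3 * Q ≤ a) :
    ∑ n ∈ Finset.Ioc m (m + K), b.cost n (size n) + t ≤ a * (d' + 1) - b.cost m d' :=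
  baseT_182 _ a Q (b.cost m d') _ d' t hd' le_rfl hrhs hcost ht hcond

/-- **CASE 2 CONCLUDED WITH THE TERM**: (1.80)⁺ at scale `j+1` for the merged component `Z` — horizon `K`, profile
`size`, terminal term `tZ`, any budget `κZ` at least (1.85) (`hκZ`; (1.85) is `Step.Budget.merge contrib S (cost S)
(P S)` with `contrib x = bracket x + P {x}`) — from the inner induction `mergeT_rhs_le` on the whole family, the
identification of the family's (1.80)-sum / terminal term at `S` with `Z`'s (`hrhsZ`, `htZ`). [cite: Balaban1989LargeFieldII, (1.85)–(1.88) pp.386–387] -/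
theorem mergeT_controls (b : Budget.Consts) (j : ℕ) {ι : Type*} [DecidableEq ι] (contrib : ι → ℝ)
    (cost P rhs t : Finset ι → ℝ) (S : Finset ι) (hne : S.Nonempty) (Conn : Finset ι → Prop) (hconn : Conn S)
    (q E Et D : ℝ)
    (hleaf : ∀ T, T ⊆ S → Conn T → 2 ≤ T.card → ∃ x ∈ T, Conn (T.erase x))
    (hsingle : ∀ x ∈ S, rhs {x} + t {x} ≤ merge contrib {x} (cost {x}) (P {x}))
    (hP : ∀ T x, T ⊆ S → x ∈ T → 2 ≤ T.card → q ≤ P {x} + P (T.erase x) - P T)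
    (hc : ∀ T x, T ⊆ S → x ∈ T → 2 ≤ T.card → Conn T → Conn (T.erase x) →
      cost T ≤ cost {x} + cost (T.erase x) + D)
    (hsub : ∀ T x, T ⊆ S → x ∈ T → 2 ≤ T.card → Conn T → Conn (T.erase x) →
      rhs T ≤ rhs {x} + rhs (T.erase x) + E)
    (htsub : ∀ T x, T ⊆ S → x ∈ T → 2 ≤ T.card → Conn T → Conn (T.erase x) →
      t T ≤ t {x} + t (T.erase x) + Et)
    (hbudget : E + Et + D ≤ q)
    (K : ℕ) (size : ℕ → ℝ) (κZ tZ : ℝ)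
    (hrhsZ : ∑ n ∈ Finset.Ioc (j + 1) (j + 1 + K), b.cost n (size n) ≤ rhs S) (htZ : tZ ≤ t S)
    (hκZ : merge contrib S (cost S) (P S) ≤ κZ) :
    Controls b (j + 1) K (κZ - tZ) size := by
  have h := mergeT_rhs_le contrib cost P rhs t S Conn q E Et D hleaf hsingle hP hc hsub htsub hbudget S le_rfl
    hconn hne
  rw [controlsT_iff]
  linarith

/-! ## §4. The outer induction on `j` for (1.80)⁺ -/

/-- **THE INDUCTIVE STATEMENT (1.80)⁺ FOR ALL SCALES** («We prove this statement by an induction with respect to j»):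
over bookkeeping data `D j` and terminal terms `t j` at every scale, from (1.80)⁺ for every component at a first scale
`j₀` (the base case, assembled from `bornT_controls` as `B16Lem384Induction.invariant_base` assembles (1.80)) and a step
`j → j+1` at every scale (assembled, component by component of `Z_{j+1}`, from the printed cases `case1T_183` /
`resetT_p386` / `bornT_controls` / `mergeT_controls` and the monotonicity `controlsT_mono` — every budget enters as a
LOWER bound by its case value), (1.80)⁺ holds for every component of every `Z_j`, `j ≥ j₀`. [cite: Balaban1989LargeFieldII, (1.80) p.384, proof pp.384–387] -/
theorem invariantT_all (b : Budget.Consts) (D : (j : ℕ) → ScaleData j) (t : (j : ℕ) → (D j).Comp → ℝ) (j₀ : ℕ)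
    (hbase : ∀ Z, Controls b j₀ ((D j₀).K Z) ((D j₀).κ Z - t j₀ Z) ((D j₀).size Z))
    (hstep : ∀ j, j₀ ≤ j → (∀ Z, Controls b j ((D j).K Z) ((D j).κ Z - t j Z) ((D j).size Z)) →
      ∀ Z, Controls b (j + 1) ((D (j + 1)).K Z) ((D (j + 1)).κ Z - t (j + 1) Z) ((D (j + 1)).size Z)) :
    ∀ j, j₀ ≤ j → ∀ Z, Controls b j ((D j).K Z) ((D j).κ Z - t j Z) ((D j).size Z) := by
  intro j hj
  induction j, hj using Nat.le_induction with
  | base => exact hbase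
  | succ j hj ih => exact hstep j hj ih

/-- With non-negative terminal terms the strengthened history implies the tree's `ScaleData.Invariant` at every scale —
so everything `B16Lem384Induction` concludes from (1.80) (e.g. `fundIneq189_of_invariant`) is available as well. [cite: Balaban1989LargeFieldII, (1.80) p.384] -/
theorem invariant_all_of_invariantT (b : Budget.Consts) (D : (j : ℕ) → ScaleData j)
    (t : (j : ℕ) → (D j).Comp → ℝ) (j₀ : ℕ) (ht : ∀ j Z, 0 ≤ t j Z)
    (hall : ∀ j, j₀ ≤ j → ∀ Z, Controls b j ((D j).K Z) ((D j).κ Z - t j Z) ((D j).size Z)) :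
    ∀ j, j₀ ≤ j → (D j).Invariant b :=
  fun j hj => invariant_of_invariantT b (D j) (t j) (ht j) (hall j hj)

/-! ## §5. The conclusion of p. 387 with the FULL budget -/

/-- `K = 0` under (1.80)⁺: the budget of a component at its horizon dominates its terminal term, `t_k(X) ≤ κ_k(X)` —
the non-empty content that replaces print's «therefore κ_k(X) ≧ 0». [cite: Balaban1989LargeFieldII, p.387] -/
theorem terminal_le_kappa_of_controlsT (b : Budget.Consts) {k : ℕ} {D : ScaleData k} (t : D.Comp → ℝ)
    (hD : ∀ Z, Controls b k (D.K Z) (D.κ Z - t Z) (D.size Z)) (X : D.Comp) (hK : D.K X = 0) : t X ≤ D.κ X := by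
  have h := hD X
  rw [hK] at h
  exact (controlsT_zero_iff b k (D.κ X) (t X) (D.size X)).mp h

/-- **THE IMPROVED (1.89) WITH THE FULL BUDGET** — p. 387 «an improved bound (1.89), with the additional term −κ₁d_k(X)
in the exponential»: from the factor form of p. 384 `𝐓′_k(X)1 ≤ exp(−κ_k(X) − 2p₀(g_{j(X)}))` (`hT`, `P` = the
`2p₀`-term), the terminal domination `κ₁d_k(X) ≤ κ_k(X)` (`hκ`, = (1.80)⁺ at `K = 0` with `t_k(X) = κ₁d_k(X)`) and the
profile slack «2p₀(g_{j(X)}) ≥ 2(1+β₀)⁻¹p₀(g_k)» (`hP`):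
`𝐓′_k(X)1 ≤ exp(−2(1+β₀)⁻¹p₀(g_k) − κ₁d_k(X))`. [cite: Balaban1989LargeFieldII, (1.89) p.387 ll.25–29] -/
theorem improved189_full {V : Type*} (T1X : V → ℝ) (A₀ : ℝ) (p₀ : ℕ) (β₀ gk κ P κ₁ dX : ℝ)
    (hT : ∀ v, T1X v ≤ Real.exp (-κ - P)) (hκ : κ₁ * dX ≤ κ) (hP : 2 * (1 + β₀)⁻¹ * p0Profile A₀ p₀ gk ≤ P) :
    ∀ v, T1X v ≤ Real.exp (-(2 * (1 + β₀)⁻¹ * p0Profile A₀ p₀ gk) - κ₁ * dX) := by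
  intro v
  refine le_trans (hT v) (Real.exp_le_exp.mpr ?_)
  linarith

/-- The same from (1.80)⁺ at scale `k` for a horizon-`0` component `X` whose terminal term is `κ₁d_k(X)`. [cite: Balaban1989LargeFieldII, (1.89) p.387 ll.25–29] -/
theorem improved189_full_of_controlsT (b : Budget.Consts) (k : ℕ) (κ : ℝ) (s : ℕ → ℝ) (κ₁ dX : ℝ)
    (hC : Controls b k 0 (κ - κ₁ * dX) s) {V : Type*} (T1X : V → ℝ) (A₀ : ℝ) (p₀ : ℕ) (β₀ gk P : ℝ)
    (hT : ∀ v, T1X v ≤ Real.exp (-κ - P)) (hP : 2 * (1 + β₀)⁻¹ * p0Profile A₀ p₀ gk ≤ P) :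
    ∀ v, T1X v ≤ Real.exp (-(2 * (1 + β₀)⁻¹ * p0Profile A₀ p₀ gk) - κ₁ * dX) :=
  improved189_full T1X A₀ p₀ β₀ gk κ P κ₁ dX hT ((controlsT_zero_iff b k κ (κ₁ * dX) s).mp hC) hP

/-- The same from (1.80)⁺ for every component of scale-`k` data whose terminal terms dominate `κ₁ ×` the tree length
`d` of the components (`hd : κ₁ d X ≤ t X` — equality for print's candidate `t_k = κ₁d_k` at horizon `0`). [cite: Balaban1989LargeFieldII, (1.89) p.387 ll.25–29] -/
theorem improved189_full_of_invariantT (b : Budget.Consts) {k : ℕ} {D : ScaleData k} (t : D.Comp → ℝ)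
    (hD : ∀ Z, Controls b k (D.K Z) (D.κ Z - t Z) (D.size Z)) (X : D.Comp) (hK : D.K X = 0)
    (κ₁ : ℝ) (d : D.Comp → ℝ) (hd : κ₁ * d X ≤ t X)
    {V : Type*} (T1X : V → ℝ) (A₀ : ℝ) (p₀ : ℕ) (β₀ gk P : ℝ)
    (hT : ∀ v, T1X v ≤ Real.exp (-D.κ X - P)) (hP : 2 * (1 + β₀)⁻¹ * p0Profile A₀ p₀ gk ≤ P) :
    ∀ v, T1X v ≤ Real.exp (-(2 * (1 + β₀)⁻¹ * p0Profile A₀ p₀ gk) - κ₁ * d X) :=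
  improved189_full T1X A₀ p₀ β₀ gk (D.κ X) P κ₁ (d X) hT
    (le_trans hd (terminal_le_kappa_of_controlsT b t hD X hK)) hP

/-- **THE CAPSTONE**: (1.80)⁺ at a first scale, a step at every scale, and a horizon-`0` component `X` of `Z_k` with
`κ₁d_k(X) ≤ t_k(X)` give the improved (1.89) with the full budget for `X` — §4 ∘ §5, the sketched route of GAPS G-adv3-6
(3) written and checked in the bookkeeping model. [cite: Balaban1989LargeFieldII, (1.80) p.384, (1.89) p.387 ll.25–29] -/
theorem improved189_full_of_history (b : Budget.Consts) (D : (j : ℕ) → ScaleData j)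
    (t : (j : ℕ) → (D j).Comp → ℝ) (j₀ : ℕ)
    (hbase : ∀ Z, Controls b j₀ ((D j₀).K Z) ((D j₀).κ Z - t j₀ Z) ((D j₀).size Z))
    (hstep : ∀ j, j₀ ≤ j → (∀ Z, Controls b j ((D j).K Z) ((D j).κ Z - t j Z) ((D j).size Z)) →
      ∀ Z, Controls b (j + 1) ((D (j + 1)).K Z) ((D (j + 1)).κ Z - t (j + 1) Z) ((D (j + 1)).size Z))
    {k : ℕ} (hk : j₀ ≤ k) (X : (D k).Comp) (hK : (D k).K X = 0) (κ₁ : ℝ) (d : (D k).Comp → ℝ)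
    (hd : κ₁ * d X ≤ t k X) {V : Type*} (T1X : V → ℝ) (A₀ : ℝ) (p₀ : ℕ) (β₀ gk P : ℝ)
    (hT : ∀ v, T1X v ≤ Real.exp (-(D k).κ X - P)) (hP : 2 * (1 + β₀)⁻¹ * p0Profile A₀ p₀ gk ≤ P) :
    ∀ v, T1X v ≤ Real.exp (-(2 * (1 + β₀)⁻¹ * p0Profile A₀ p₀ gk) - κ₁ * d X) :=
  improved189_full_of_invariantT b (t k) (invariantT_all b D t j₀ hbase hstep k hk) X hK κ₁ d hd T1X A₀ p₀ β₀ gk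
    P hT hP

/-- The full-budget improved bound implies (1.89) proper (`Step.FundIneq189`) as soon as `κ₁d_k(X) ≥ 0`. [cite: Balaban1989LargeFieldII, (1.89) p.387] -/
theorem fundIneq189_of_improved189_full {V : Type*} (T1X : V → ℝ) (A₀ : ℝ) (p₀ : ℕ) (β₀ gk κ₁ dX : ℝ)
    (hd : 0 ≤ κ₁ * dX)
    (h : ∀ v, T1X v ≤ Real.exp (-(2 * (1 + β₀)⁻¹ * p0Profile A₀ p₀ gk) - κ₁ * dX)) :
    FundIneq189 T1X A₀ p₀ β₀ gk := by
  intro v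
  refine le_trans (h v) (Real.exp_le_exp.mpr ?_)
  linarith

/-- The full-budget improved bound implies the tree's HALF-budget shape (`B16Improved189.improved189_of_fundIneq`'s
conclusion `exp(−(1+β₀)⁻¹p₀(g_k) − κ₁d_k(X))`) as soon as `(1+β₀)⁻¹p₀(g_k) ≥ 0` — the repair of G-adv3-6 (2) is the
weaker statement. [cite: Balaban1989LargeFieldII, (1.89) p.387] -/
theorem improved189_half_of_full {V : Type*} (T1X : V → ℝ) (A₀ : ℝ) (p₀ : ℕ) (β₀ gk κ₁ dX : ℝ)
    (hp : 0 ≤ (1 + β₀)⁻¹ * p0Profile A₀ p₀ gk)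
    (h : ∀ v, T1X v ≤ Real.exp (-(2 * (1 + β₀)⁻¹ * p0Profile A₀ p₀ gk) - κ₁ * dX)) :
    ∀ v, T1X v ≤ Real.exp (-((1 + β₀)⁻¹ * p0Profile A₀ p₀ gk) - κ₁ * dX) := by
  intro v
  refine le_trans (h v) (Real.exp_le_exp.mpr ?_)
  linarith

/-- THE `hw`-CURRENCY OF THE COR-3 CHAIN (`B16Cor3Wilson.uvIneq_of_repr172_wilson`'s per-component leaf `hw : T_X[B_X]
≤ exp(−c₀ − κ₁d_k(X))`): the full-budget bound is that shape with `c₀ = 2(1+β₀)⁻¹p₀(g_k)` — twice the constant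
`B16Cor3Wilson.hw_of_improved189` supplies. [cite: Balaban1989LargeFieldII, (1.89) p.387, (2.50) of [III]] -/
theorem hw_full_shape {V : Type*} (T1X : V → ℝ) (A₀ : ℝ) (p₀ : ℕ) (β₀ gk κ P κ₁ dX : ℝ)
    (hT : ∀ v, T1X v ≤ Real.exp (-κ - P)) (hκ : κ₁ * dX ≤ κ) (hP : 2 * (1 + β₀)⁻¹ * p0Profile A₀ p₀ gk ≤ P) :
    ∃ c₀ : ℝ, c₀ = 2 * (1 + β₀)⁻¹ * p0Profile A₀ p₀ gk ∧ ∀ v, T1X v ≤ Real.exp (-c₀ - κ₁ * dX) :=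
  ⟨_, rfl, improved189_full T1X A₀ p₀ β₀ gk κ P κ₁ dX hT hκ hP⟩

/-! ## §6. Non-vacuity: a two-scale history with a positive terminal term -/

/-- **The strengthened hypotheses are jointly satisfiable with a non-zero term, and the full-budget conclusion then
fires with a non-zero added exponent.**  Bookkeeping constants `O(1) = M = 1`, `d = 1`, `R ≡ 1` (so `cost n s = s`); a
region born at scale `1` with coefficient `a = 3`, size `d′ = 1`, profile `≡ 1`, horizon `K = 1`, majorant constant
`Q = 1` (`3Q ≤ a`) and terminal term `t = 2 ≤ Q(d′+1)`: its budget `κ₁ = a(d′+1) − cost = 5` satisfies (1.80)⁺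
(`bornT_controls`); one continuation (1.83) brings it to its horizon at scale `2` with budget `4` and the same term
(`case1T_183`); there (1.80)⁺ reads `2 ≤ 4` and any factor bound `𝐓′1 ≤ exp(−4 − P)` with `2(1+β₀)⁻¹p₀ ≤ P` yields the
full-budget improved bound with `κ₁d = 2`. [cite: Balaban1989LargeFieldII, (1.82)–(1.83) p.385, (1.89) p.387] -/
theorem toy_history_full {V : Type*} (T1X : V → ℝ) (A₀ : ℝ) (p₀ : ℕ) (β₀ gk P : ℝ)
    (hT : ∀ v, T1X v ≤ Real.exp (-4 - P)) (hP : 2 * (1 + β₀)⁻¹ * p0Profile A₀ p₀ gk ≤ P) :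
    let b : Budget.Consts := ⟨1, 1, 1, fun _ => 1⟩
    Controls b 1 1 (5 - 2) (fun _ => 1) ∧ Controls b 2 0 (4 - 2) (fun _ => 1) ∧
      ∀ v, T1X v ≤ Real.exp (-(2 * (1 + β₀)⁻¹ * p0Profile A₀ p₀ gk) - 2) := by
  intro b
  have hcost : ∀ n (s : ℝ), b.cost n s = s := by
    intro n s
    simp [b, Budget.Consts.cost]
  have h1 : Controls b 1 1 (5 - 2) (fun _ => 1) := by
    refine bornT_controls b 1 1 5 3 1 2 1 (fun _ => 1) zero_le_one ?_ ?_ ?_ ?_ ?_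
    · rw [hcost]; norm_num
    · rw [show (1 : ℕ) + 1 = 2 by rfl, show Finset.Ioc 1 2 = {2} by rfl, Finset.sum_singleton, hcost]; norm_num
    · rw [hcost]; norm_num
    · norm_num
    · norm_num
  have h2 : Controls b 2 0 (4 - 2) (fun _ => 1) := by
    have h := case1T_183 b 1 1 le_rfl 5 2 (fun _ => 1) h1
    rw [hcost] at h
    norm_num at h
    rw [show (4 : ℝ) - 2 = 2 by norm_num]
    exact h
  refine ⟨h1, h2, ?_⟩
  have h3 := improved189_full_of_controlsT b 2 4 (fun _ => 1) 1 2 (by simpa using h2) T1X A₀ p₀ β₀ gk P hT hP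
  simpa using h3

/-! ## §7. The terminal binder at birth / reset in the ℤᵈ index model: condition (i) at the terminal scale, BY NAME

The one new smallness-type binder of §2, `ht : t ≤ Q(d′+1)`, in print's currency `t = κ₁·d_{j+K}(S^K(Z))` (the tree
length, in `M`-cubes [B12] p. 257, of the terminal domain, a union of `MR_{j+K}`-cubes): by the very DEFINITION of the
horizon («K is the smallest positive integer having the property that the domain S^K(Z) … satisfies the conditions (i),
(ii)», p. 384) the terminal domain satisfies (i) — «contained in a cube of the size 100MR» ([IV] p. 177) — so it has at
most `(100R_{j+K})^d` M-cubes and its tree length is at most `(100R_{j+K})^d − 1`; `ht` is then the located clause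
`κ₁((100R_{j+K})^d − 1) ≤ Q` (with `R_{j+K} ≤ LR_j` on the control range by (2.9) [III] and `Q = O(1)(64)^dM^dL^{d+1}
R_j^{d+2}`: a smallness condition on `κ₁` of the kind p. 389 prints, cf. `B16Improved189.size_trade_of_exponents`).  Read
in the cell's ℤᵈ index model through the two-lattice dictionary of `B16Ineq197ClassOne` (`fineCubes R S` = the M-cubes of
the union of the MR-cubes indexed by `S`; `card_fineCubes_le_of_condI`, `faceConnected_fineCubes`) and pv22's tree length
(`TreeLength.treeLen_le_card_sub_one`). -/

section IndexModel

open Literature.MathematicalPhysics.QuantumFieldTheory.Balaban1983to89.B13ScaleTransfer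
open Literature.MathematicalPhysics.QuantumFieldTheory.Balaban1983to89.TreeLength
open Literature.MathematicalPhysics.QuantumFieldTheory.Balaban1983to89.B16StoppingRule (CondI)
open Literature.MathematicalPhysics.QuantumFieldTheory.Balaban1983to89.B13Factor210Literal (fineCubes)
open Literature.MathematicalPhysics.QuantumFieldTheory.Balaban1983to89.B16Ineq197ClassOne
  (fineCubes_nonempty_iff card_fineCubes_le_of_condI faceConnected_fineCubes)

variable {n : ℕ}

/-- THE TERMINAL TREE LENGTH UNDER CONDITION (i): a non-empty face-connected union of `MR`-cubes (index set `SK`) fitting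
in a cube of `Nsz` MR-cubes per side (`CondI Nsz SK`; print `Nsz = 100`) has M-cube tree length
`d(S^K(Z)) ≤ (Nsz·R)^d − 1`. [cite: Balaban1989LargeFieldI, p.177 (condition (i)); Balaban1987RG1, p.257 (linear size d_j)] -/
theorem terminal_treeLen_le_of_condI {R Nsz : ℕ} (hR : 0 < R) {SK : Finset (Pt n)} (hne : SK.Nonempty)
    (hfc : FaceConnected SK) (hI : CondI Nsz SK) :
    treeLen (fineCubes R SK) ≤ ((Nsz : ℝ) * R) ^ n - 1 := by
  have h1 := treeLen_le_card_sub_one ((fineCubes_nonempty_iff hR).2 hne) (faceConnected_fineCubes hR hfc)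
  have h2 : ((fineCubes R SK).card : ℝ) ≤ ((Nsz : ℝ) * R) ^ n := by
    have := card_fineCubes_le_of_condI hR hI
    exact_mod_cast this
  linarith

/-- **THE BINDER `ht` OF §2 DISCHARGED FROM THE DEFINITION OF THE HORIZON**, modulo the located clause: with
`t := κ₁·d(S^K(Z))` (M-cube tree length of the terminal domain `fineCubes R SK`, `κ₁ ≥ 0`), condition (i) for the terminal
index set and `κ₁((Nsz·R)^d − 1) ≤ Q` give `t ≤ Q(d′+1)` for every size `d′ ≥ 0` — the hypothesis `ht` of
`bornT_controls` / `hsingleT_new`, and (with `p` for `Q(d′+1)`) the charge in `resetT_p386`'s `hsmall`. [cite: Balaban1989LargeFieldII, p.384 (definition of K), (1.82) p.385] -/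
theorem ht_of_condI {R Nsz : ℕ} (hR : 0 < R) {SK : Finset (Pt n)} (hne : SK.Nonempty) (hfc : FaceConnected SK)
    (hI : CondI Nsz SK) {κ₁ Q d' : ℝ} (hκ₁ : 0 ≤ κ₁) (hd' : 0 ≤ d')
    (hclause : κ₁ * (((Nsz : ℝ) * R) ^ n - 1) ≤ Q) :
    κ₁ * treeLen (fineCubes R SK) ≤ Q * (d' + 1) := by
  have h1 := mul_le_mul_of_nonneg_left (terminal_treeLen_le_of_condI hR hne hfc hI) hκ₁
  have hQ : 0 ≤ Q := le_trans (mul_nonneg hκ₁ (by linarith [treeLen_nonneg (fineCubes R SK)])) (h1.trans hclause)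
  calc κ₁ * treeLen (fineCubes R SK) ≤ Q := h1.trans hclause
    _ = Q * 1 := (mul_one Q).symm
    _ ≤ Q * (d' + 1) := mul_le_mul_of_nonneg_left (by linarith) hQ

/-- THE HORIZON-0 CASE (the domains `X` of (1.71), p. 387): there the terminal domain is `X` itself at scale `k`, the
terminal term is `κ₁d_k(X)` with `d_k(X) ≤ (Nsz·R_k)^d − 1` — the `hgeo : d_k(X) ≤ (100R_k)^d` of
`B16Improved189.improved189_of_condition_i`, now feeding the FULL-budget bound instead of the size trade. [cite: Balaban1989LargeFieldII, p.387; Balaban1989LargeFieldI, p.177 (condition (i))] -/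
theorem hgeo_of_condI {R Nsz : ℕ} (hR : 0 < R) {SK : Finset (Pt n)} (hne : SK.Nonempty) (hfc : FaceConnected SK)
    (hI : CondI Nsz SK) : treeLen (fineCubes R SK) ≤ ((Nsz : ℝ) * R) ^ n :=
  (terminal_treeLen_le_of_condI hR hne hfc hI).trans (by linarith)

end IndexModel

end Literature.MathematicalPhysics.QuantumFieldTheory.Balaban1983to89.B16Improved189FullBudget
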